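import Summits.AtomisticToContinuum.BoseEinsteinCondensation.Theses.BECDistantTilts
import Summits.AtomisticToContinuum.BoseEinsteinCondensation.Theses.BECPhononFloor
import Summits.AtomisticToContinuum.BoseEinsteinCondensation.Theorems.BECPhononFloorFloorModeCounting
import Literature.MathematicalPhysics.QuantumManyBody.PeriodicBoseGasFracEnergy
import Literature.MathematicalPhysics.QuantumManyBody.BoseGasThermodynamicLimitRuelle

/-!
# Crux `PeriodicBEC` (stmt-AtomisticToContinuum-8997) — strategist r1: the two honest route-level
# splits, typed and kernel-checked (NOT filed; see `STRATEGY-CENSUS-r1.md` §Decomposition)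

* `DeepIRCube` — the weakest typing of the infrared heart: for SOME fixed fraction `K₀` of the
  inverse healing momentum, the plane waves `0 < |n|_∞ ≤ K₀ L√ρ/2π` carry at most `θN`, `θ < 1`
  uniform in `ρ < ρ₀` and `N` (cube / `cellWave` coordinates of items 11453/11454).
* `periodicBEC_of_mesoscopicTail_deepIRCube` —
  `BECPhononFloor.MesoscopicTail (item 11454) → DeepIRCube → BECDistantTilts.PeriodicBEC` (by name).
* `periodicBEC_of_phononFloor_mesoscopicTail` —
  `BECPhononFloor.PhononFloor (11453) → BECPhononFloor.MesoscopicTail (11454) → BECDistantTilts.PeriodicBEC`,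
  a two-line wrapper of the LANDED `Theorems.FloorModeCounting_proof` (p100201).
-/

noncomputable section

open MeasureTheory Filter
open scoped ENNReal NNReal BigOperators

namespace Summit.AtomisticToContinuum.BoseEinsteinCondensation.Cruxes.PeriodicBEC.StrategistR1

open Literature.MathematicalPhysics.QuantumManyBody.BoseGas
open Summit.AtomisticToContinuum.BoseEinsteinCondensation.Theorems
open Summit.AtomisticToContinuum.BoseEinsteinCondensation.Theorems.FloorModeCounting

/-- **DeepIRCube** (candidate child, crux): no infrared catastrophe in the deep-infrared cube.
For every repulsive finite-range `v` there are `θ ∈ [0,1)`, `K₀ > 0`, `ρ₀ > 0` such that for all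
`0 < ρ < ρ₀`, eventually in `N`, for some `δ > 0`, every periodic `δ`-near-minimiser `Ψ` on the
torus of side `L = (N/ρ)^{1/3}` has `∑_{n ∈ cube(m) ∖ {0}} n_Ψ(n) ≤ θN` for every `m ≤ K₀L√ρ/2π`. -/
def DeepIRCube : Prop :=
  ∀ v : ℝ → ENNReal, Literature.MathematicalPhysics.QuantumManyBody.BoseGas.IsRepulsiveFiniteRange v → ∃ θ : ℝ, 0 ≤ θ ∧ θ < 1 ∧ ∃ K₀ : ℝ, 0 < K₀ ∧ ∃ ρ₀ : ℝ, 0 < ρ₀ ∧ ∀ ρ : ℝ, 0 < ρ → ρ < ρ₀ → ∀ᶠ N : ℕ in Filter.atTop, ∃ δ : ENNReal, 0 < δ ∧ ∀ Ψ : Literature.MathematicalPhysics.QuantumManyBody.BoseGas.PeriodicTrialState N (Literature.MathematicalPhysics.QuantumManyBody.BoseGas.sideLength ρ N), Literature.MathematicalPhysics.QuantumManyBody.BoseGas.periodicEnergy v Ψ ≤ Literature.MathematicalPhysics.QuantumManyBody.BoseGas.periodicGroundStateEnergy v N (Literature.MathematicalPhysics.QuantumManyBody.BoseGas.sideLength ρ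 N) + δ → ∀ m : ℕ, (m : ℝ) ≤ K₀ * Literature.MathematicalPhysics.QuantumManyBody.BoseGas.sideLength ρ N * Real.sqrt ρ / (2 * Real.pi) → (∑ n ∈ Finset.Icc (fun _ : Fin 3 => -((m : ℤ))) (fun _ : Fin 3 => ((m : ℤ))) \ {0}, Literature.MathematicalPhysics.QuantumManyBody.BoseGas.cellOccupation N (Literature.MathematicalPhysics.QuantumManyBody.BoseGas.sideLength ρ N) (fun x => ((Real.sqrt (Literature.MathematicalPhysics.QuantumManyBody.BoseGas.sideLength ρ N ^ 3))⁻¹ : ℂ) * Literature.MathematicalPhysics.QuantumManyBody.BoseGas.cellWave (Literature.MathematicalPhysics.QuantumManyBody.BoseGas.sideLength ρ N) n x) Ψ.ψ) ≤ ENNReal.ofReal (θ * N)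

/-- **Split A (glue, proved):** mesoscopic tail `∧` deep-infrared cube bound `⇒` torus BEC with
`c = (1 - θ)/2`: `ε := (1-θ)/2`, `m := ⌈K₀L√ρ/2π⌉₊ - 1`, Parseval `∑ₙ n_Ψ(n) = N`, `n_Ψ(0) = n₀`.
[cite: LSSY2005, §1.2 (1.17)–(1.19)] -/
theorem periodicBEC_of_mesoscopicTail_deepIRCube :
    Summit.AtomisticToContinuum.BoseEinsteinCondensation.Theses.BECPhononFloor.MesoscopicTail →
    DeepIRCube →
    Summit.AtomisticToContinuum.BoseEinsteinCondensation.Theses.BECDistantTilts.PeriodicBEC := by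
  intro hMT hIR v hv
  obtain ⟨θ, hθ0, hθ1, K₀, hK₀, ρ₂, hρ₂, hIR⟩ := hIR v hv
  set ε : ℝ := (1 - θ) / 2 with hε
  have hε0 : 0 < ε := by rw [hε]; linarith
  obtain ⟨ρ₁, hρ₁, hMT⟩ := hMT v hv K₀ hK₀ ε hε0
  refine ⟨min ρ₁ ρ₂, lt_min hρ₁ hρ₂, fun ρ hρ hρlt => ⟨ε, hε0, ?_⟩⟩
  have hρlt₁ : ρ < ρ₁ := hρlt.trans_le (min_le_left _ _)
  have hρlt₂ : ρ < ρ₂ := hρlt.trans_le (min_le_right _ _)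
  filter_upwards [hMT ρ hρ hρlt₁, hIR ρ hρ hρlt₂,
    (tendsto_sideLength_atTop hρ).eventually_ge_atTop 1] with N hMTN hIRN hLge
  clear hMT hIR
  generalize sideLength ρ N = L at hMTN hIRN hLge ⊢
  have hL : 0 < L := one_pos.trans_le hLge
  set R : ℝ := K₀ * L * Real.sqrt ρ / (2 * Real.pi) with hR
  have hR0 : 0 ≤ R := by positivity
  set m : ℕ := ⌈R⌉₊ - 1 with hm
  have hm1 : R ≤ (m : ℝ) + 1 := by
    have h1 : ⌈R⌉₊ ≤ m + 1 := by rw [hm]; omega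
    calc R ≤ (⌈R⌉₊ : ℝ) := Nat.le_ceil _
      _ ≤ ((m + 1 : ℕ) : ℝ) := by exact_mod_cast h1
      _ = (m : ℝ) + 1 := by push_cast; ring
  have hmR : (m : ℝ) ≤ R := by
    rcases Nat.eq_zero_or_pos ⌈R⌉₊ with h0 | hpos
    · have : m = 0 := by rw [hm, h0]
      rw [this, Nat.cast_zero]
      exact hR0
    · have h1 : (m : ℝ) = (⌈R⌉₊ : ℝ) - 1 := by
        rw [hm, Nat.cast_sub (by omega), Nat.cast_one]
      have h2 := Nat.ceil_lt_add_one hR0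
      linarith
  obtain ⟨δ₁, hδ₁, hMTN⟩ := hMTN
  obtain ⟨δ₂, hδ₂, hIRN⟩ := hIRN
  refine ⟨min δ₁ δ₂, lt_min hδ₁ hδ₂, fun Ψ hΨ => ?_⟩
  have hMTΨ := hMTN Ψ (hΨ.trans (add_le_add le_rfl (min_le_left _ _)))
  have hIRΨ := hIRN Ψ (hΨ.trans (add_le_add le_rfl (min_le_right _ _)))
  clear hMTN hIRN
  -- occupations and cube sums
  set occ : (Fin 3 → ℤ) → ℝ≥0∞ := fun n =>
    cellOccupation N L (fun x => ((Real.sqrt (L ^ 3))⁻¹ : ℂ) * cellWave L n x) Ψ.ψ with hocc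
  have hmode : ∀ n : Fin 3 → ℤ,
      (fun x => ((Real.sqrt (L ^ 3))⁻¹ : ℂ) * cellWave L n x) = planeWaveMode L n := fun n =>
    funext fun x => (planeWaveMode_eq L n x).symm
  have hoccn : ∀ n, occ n = cellOccupation N L (planeWaveMode L n) Ψ.ψ := fun n =>
    congrArg (fun φ => cellOccupation N L φ Ψ.ψ) (hmode n)
  set Q : ℕ → ℝ≥0∞ := fun M =>
    ∑ n ∈ Finset.Icc (fun _ : Fin 3 => -(M : ℤ)) (fun _ : Fin 3 => (M : ℤ)), occ n with hQ
  set T : ℕ → ℕ → ℝ≥0∞ := fun m' M =>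
    ∑ n ∈ Finset.Icc (fun _ : Fin 3 => -(M : ℤ)) (fun _ : Fin 3 => (M : ℤ)) \
      Finset.Icc (fun _ : Fin 3 => -(m' : ℤ)) (fun _ : Fin 3 => (m' : ℤ)), occ n with hT
  have hQmono : ∀ M M' : ℕ, M ≤ M' → Q M ≤ Q M' := fun M M' h =>
    Finset.sum_le_sum_of_subset fun n hn => mem_cube.2 ((mem_cube.1 hn).trans h)
  -- (IR) the punctured cube of radius `m ≤ R` carries at most `θN`
  have hIRm : (∑ n ∈ Finset.Icc (fun _ : Fin 3 => -(m : ℤ)) (fun _ : Fin 3 => (m : ℤ)) \ {0}, occ n)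
      ≤ ENNReal.ofReal (θ * N) := hIRΨ m hmR
  -- (tail) everything beyond the cube of radius `m` (`m + 1 ≥ R`) carries at most `εN`
  have hUV : ∀ M : ℕ, T m M ≤ ENNReal.ofReal (ε * N) := fun M => hMTΨ m M hm1
  -- (split of a cube at the origin)
  have h0mem : ∀ M : ℕ, ({0} : Finset (Fin 3 → ℤ)) ⊆
      Finset.Icc (fun _ : Fin 3 => -(M : ℤ)) (fun _ : Fin 3 => (M : ℤ)) := fun M => by
    rw [Finset.singleton_subset_iff, Finset.mem_Icc]
    exact ⟨fun k => by simp, fun k => by simp⟩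
  have hQsplit : Q m = occ 0 +
      ∑ n ∈ Finset.Icc (fun _ : Fin 3 => -(m : ℤ)) (fun _ : Fin 3 => (m : ℤ)) \ {0}, occ n := by
    rw [hQ]
    simp only
    rw [← Finset.sum_sdiff (h0mem m), Finset.sum_singleton, add_comm]
  -- (count) every cube carries at most `n₀ + θN + εN`
  set B : ℝ≥0∞ := ENNReal.ofReal (θ * N) + ENNReal.ofReal (ε * N) with hB
  have hcube : ∀ M : ℕ, Q M ≤ occ 0 + B := by
    intro M
    have hsub : Finset.Icc (fun _ : Fin 3 => -(m : ℤ)) (fun _ : Fin 3 => (m : ℤ)) ⊆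
        Finset.Icc (fun _ : Fin 3 => -((M + m : ℕ) : ℤ)) (fun _ : Fin 3 => ((M + m : ℕ) : ℤ)) :=
      fun n hn => mem_cube.2 ((mem_cube.1 hn).trans (Nat.le_add_left m M))
    calc Q M ≤ Q (M + m) := hQmono M (M + m) (Nat.le_add_right M m)
      _ = Q m + T m (M + m) := by
          simp only [hQ, hT]
          rw [← Finset.sum_sdiff hsub, add_comm]
      _ = occ 0 + (∑ n ∈ Finset.Icc (fun _ : Fin 3 => -(m : ℤ)) (fun _ : Fin 3 => (m : ℤ)) \ {0},
            occ n) + T m (M + m) := by rw [hQsplit]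
      _ ≤ occ 0 + ENNReal.ofReal (θ * N) + ENNReal.ofReal (ε * N) :=
          add_le_add (add_le_add le_rfl hIRm) (hUV _)
      _ = occ 0 + B := by rw [hB, add_assoc]
  -- (Parseval) `N = ∑ₙ n_Ψ(n) = sup_M Q M ≤ n₀ + B`
  have hsum : (N : ℝ≥0∞) ≤ occ 0 + B := by
    calc (N : ℝ≥0∞) = ∑' n, occ n := by
          simp only [hoccn]
          exact (Ψ.tsum_cellOccupation_planeWaveMode hL).symm
      _ = ⨆ M : ℕ, Q M := ENNReal.tsum_eq_iSup_sum' _ exists_subset_cube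
      _ ≤ occ 0 + B := iSup_le hcube
  -- (arithmetic) `εN + θN + εN = N`
  have hBtop : B ≠ ⊤ := by
    rw [hB]
    exact ENNReal.add_ne_top.2 ⟨ENNReal.ofReal_ne_top, ENNReal.ofReal_ne_top⟩
  have hkey : ENNReal.ofReal (ε * N) + B ≤ (N : ℝ≥0∞) := by
    rw [hB, ← ENNReal.ofReal_add (by positivity) (by positivity),
      ← ENNReal.ofReal_add (by positivity) (by positivity), ← ENNReal.ofReal_natCast]
    refine ENNReal.ofReal_le_ofReal (le_of_eq ?_)
    rw [hε]
    ring
  have h0 : occ 0 = condensateOccupation N L Ψ.ψ := by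
    rw [hoccn 0, cellOccupation_planeWaveMode_zero]
  rw [← h0]
  exact ENNReal.le_of_add_le_add_right hBtop (hkey.trans hsum)

/-- **Split B (glue, = the landed `FloorModeCounting_proof` by name):** phonon floor `∧`
mesoscopic tail `⇒` torus BEC. [cite: LSSY2005, §1.2 (1.17)–(1.19)] -/
theorem periodicBEC_of_phononFloor_mesoscopicTail :
    Summit.AtomisticToContinuum.BoseEinsteinCondensation.Theses.BECPhononFloor.PhononFloor →
    Summit.AtomisticToContinuum.BoseEinsteinCondensation.Theses.BECPhononFloor.MesoscopicTail →
    Summit.AtomisticToContinuum.BoseEinsteinCondensation.Theses.BECDistantTilts.PeriodicBEC :=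
  fun hPF hMT v hv => FloorModeCounting_proof v hv (hPF v hv) (hMT v hv)

end Summit.AtomisticToContinuum.BoseEinsteinCondensation.Cruxes.PeriodicBEC.StrategistR1

end
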